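import Literature.MathematicalPhysics.QuantumFieldTheory.Balaban1983to89.B8Eq151V2Divergence

/-!
# `T4Continuum.ShellMeasureCommutatorVariation` — WALL §2 (a) item (P4), THE ∇-PART (row S65 f3, file 1∕3): the CUBIC
# COMMUTATOR DENSITY `w·τ((D^η_{U₀}B)(p)·{…}_B(p))`, its FIRST VARIATION along a line (an explicit cubic polynomial,
# `HasDerivAt`), the single-bond variation `ι_bX` on the infinite lattice, and the STAR `st(b)` of a bond with its
# family-by-family sum (cell `pub-balaban`, sub-cell `t4`, spine estimate NE7c (node U5b); NE7c ROUND-2 crew, unit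
# `b2b-balaban-t4-ne7c-formalise-leaf-05` gen 7; owner table `LEAVES-NE7c-P1.md` row S65 «(P4) AT THE LIVE LEVELS»,
# its third file «the ∇-part» (holder leaf-02-g8's census l.15136; OFFER l.15262); ADDITIVE — imports b08's
# `B8Eq151V2Divergence` ONLY; [folklore]; 0 sorry)

HONEST FRAMING.  Finite four-torus programme, rung (B)+1 only — NOT infinite volume, NOT a mass gap, NOT the Clay
problem, NOT summit progress; (B), `BetaPertHyp`, (B^μ) are not consumed.  NE7c (`T4IndicatorShell.ShellWeightBound`)
is NOT PRINTED and NOT PROVED; «NE7c ⇐ the named binders» (WALL `t4/b2b-balaban-t4-ne7c-p1/WALL-NE7c-P1.md` §2).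
ELEMENTARY covariant lattice calculus ([folklore]) over the b08 lineage's KERNEL modules (`B8Ineq132`,
`B8Eq143PlaqExpansion`, `B8Eq146AExpansion`, `B8Eq151V2Divergence`: the covariant derivatives (1.1) = [B9] (3.3)∕(3.8),
the plaquette covariant derivative [B9] (3.4), the adjoint divergence (1.2) = [B9] (3.9), the bracket `{…}` of (1.49)∕
(1.50), and the kernel theorems (1.50)–(1.53)); [Balaban1985Variational] (cell paper B11) p. 284 (39) and p. 292
(91)–(96) are LOCATORS for the SHAPE only — the paper is under adjudication (ABSOLUTE RULE), nothing printed is asserted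
or cited as a fact; no `def … : Prop` is minted (the `def`s are DATA).  HONEST DEPENDENCY (cell): continuum YM on T⁴ ⇐
BetaPertH ∧ nine spine estimates (0/9 proved); BetaPertH ⇐ (D1) ∧ (D4) ∧ CAP+tail; G-an2-4 gates asym, D1 and NE2/3/4.

THE POINT (owner census gen 29, locator `HOME/b2b-balaban-t4-ne7c-formalise-leaf-02/XREAD-P4-B11-SectB.md` of row S65):
END-II's (P4) binder `hW : ∀ V, Prop4Hyp (W𝒱 V) C₄ a₃` = B11 Prop. 4 (97)∕(98).  At the live levels `Ω_j`, `j ≥ 1`, the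
naive one-plaquette Taylor bound «in |A′| alone» loses EXACTLY a factor `Lʲ`, and only where `δ∕δA′(b)` hits the
`(DA′)(p)` slot of (39)'s first term `¼ i tr[(DA)(p)·Σ_{b₁<b₂⊂∂p} i[A′(b₁), A′(b₂)]]`: the single-bond variation of the
curl is `±η⁻¹R(…)X`, so the naive bound of that slot is `O(1)·η⁻¹·|A′|²`.  Print's repair, p. 292 (93) + [6] (1.52) =
(96): sum by parts — the `η⁻¹` becomes the ADJOINT derivative `D^{η*}` of the bracket, and `D^{η*}{…}` is `O(|A||∇A|)`
by the product rule (1.52) because every term of `{…}` beyond `2[A_μ, A_ν]` CARRIES an `η` ((1.50): «we use these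
factors to cancel η⁻¹») — «estimated by O(1)|∇A′||A′|».  This three-file set (`…CommutatorVariation` →
`…CommutatorByParts` → `…CommutatorGradient`) types that MECHANISM at ONE GRID of spacing `η` with the two scales
DISPLAYED as plain sup bounds `|B(b)| ≤ a`, `|∇^η_{U₀}B| ≤ G` (at level j: `a ∝ (Lʲη)⁻¹`, `G ∝ (Lʲη)⁻²` — the (98)
packaging in the weighted norms is row S65 f2's, not made here).

WHAT THIS FILE PROVES (kernel, no hypotheses at all — pure algebra and finite combinatorics):
* §1 `bump y κ X` = the bond field `ι_bX` (`X` on `⟨y, y + e_κ⟩`, `0` elsewhere; no norm on the field space is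
  needed); `dbrk` = the first variation `δ{…}(B)[H] = Σ_{i<j}([xᵢ(H), xⱼ(B)] + [xᵢ(B), xⱼ(H)])` of b08's bracket `brk`
  (the four transported plaquette variables `x₁ … x₄` are LINEAR in the field: `X?_add_smul`, `lin_add_smul`,
  `plaqCovDeriv_add_smul`, `brk_add_smul`); `cub w τ η U₀ B p := w·τ((D^η_{U₀}B)(p)·{…}_B(p))` and its variation
  `dcub`; **`cub_add_smul`** (`cub(B + tH)` is an explicit cubic polynomial in `t`), **`hasDerivAt_cub`** ∕
  **`hasDerivAt_sum_cub`** (`t ↦ Σ_{p∈Pl} cub(B + tH)(p)` has derivative `Σ_{p∈Pl} dcub(B)[H](p)` at `0` — B11's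
  `(δ∕δA′)` of the cubic term, for ANY finite plaquette set and ANY direction field).
* §2 `plaqStar y κ` — the `2(d − 1)` INCREASING plaquettes through the bond `⟨y, y + e_κ⟩` as four families (B11 (90)
  «st(b)»); membership lemmas, **`sum_plaqStar`** (the sum over the star, family by family — the shape in which b08's
  `pdiv` = (1.2)∕(3.9) reads a plaquette function), `card_plaqStar_le`, `sum_eq_sum_plaqStar` (restriction of a star-supported
  sum).
Files 2∕3: `ShellMeasureCommutatorByParts` (locality off the star + the POINTWISE SUMMATION BY PARTS
`Σ_{p∈st(b)} τ((D^η_{U₀}ι_bX)(p)·F(p)) = τ(X·(D^{η*}_{U₀}F)_κ(y))` for tracial `τ`) and `ShellMeasureCommutatorGradient`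
(the bound `|δ_bT[X]| ≤ 176(d − 1)·|w|·‖τ‖·a·G·‖X‖`, no `η⁻¹a²`).
NOT HERE (said in every headline): the identification of the cubic commutator functional with the order-3 part of the
actual one-grid Wilson action (row S65 f4, leaf-03: «ord₃ = −½τ(Y·K) + V₀′»), the weighted multi-grid norms and the (98)
packaging (S65 f2a∕f2b, leaf-02), the `HD`-dressed variants `A″ = A′ − HD(A′)` of (91)–(96) with (46)'s second clause
(S66), the torus packaging, the [dict] (node O); NE7c NOT proved; 0/9 spine.
-/

noncomputable section

open scoped BigOperators
open NormedSpace Finset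

namespace Summit.QuantumFields.BalabanUV.T4Continuum.ShellMeasureCommutatorVariation

open Literature.MathematicalPhysics.QuantumFieldTheory.Balaban1983to89
open B7Prop1Explicit (e)
open B7Eq78Linearization (conjR conjR_apply conjR_add conjR_sub conjR_smul)
open B8Eq146AExpansion (X1 X2 X3 X4 lin adR plaqCovDeriv conjR_neg)
open B8Eq151V2Divergence (brk)

-- `Site` alone would resolve to the torus sites of `Setup.lean`; re-export the `ℤ^d` sites of `B7Prop1Explicit`.
export B7Prop1Explicit (Site)

variable {d : ℕ}

/-! ## §1 The cubic commutator density and its first variation (pure algebra) -/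

section Algebra

variable {𝔸 : Type*} [NormedRing 𝔸] [NormedAlgebra ℂ 𝔸]

/-- A single-bond variation on the infinite lattice: the bond field equal to `X` on the bond `⟨y, y + e_κ⟩` and `0`
elsewhere (no norm on the field space is needed). [folklore] -/
def bump (y : Site d) (κ : Fin d) (X : 𝔸) : Site d → Fin d → 𝔸 := fun x μ => if x = y ∧ μ = κ then X else 0

omit [NormedAlgebra ℂ 𝔸] in
/-- `bump y κ X y κ = X`. [folklore] -/
theorem bump_self (y : Site d) (κ : Fin d) (X : 𝔸) : bump y κ X y κ = X := by simp [bump]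

omit [NormedAlgebra ℂ 𝔸] in
/-- `bump y κ X x μ = 0` off the bond. [folklore] -/
theorem bump_of_ne {y x : Site d} {κ μ : Fin d} (h : ¬(x = y ∧ μ = κ)) (X : 𝔸) : bump y κ X x μ = 0 := by
  simp [bump, h]

omit [NormedAlgebra ℂ 𝔸] in
/-- `‖bump y κ X x μ‖ ≤ ‖X‖`. [folklore] -/
theorem norm_bump_le (y x : Site d) (κ μ : Fin d) (X : 𝔸) : ‖bump y κ X x μ‖ ≤ ‖X‖ := by
  unfold bump
  split_ifs
  · exact le_rfl
  · simp

/-- THE FIRST VARIATION OF THE BRACKET `{…}` of B8 (1.49)∕(1.50) (b08 `brk`, six commutators of the four transported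
plaquette variables `x₁ … x₄`, each LINEAR in the field): `δ{…}(B)[H] = Σ_{i<j} ([xᵢ(H), xⱼ(B)] + [xᵢ(B), xⱼ(H)])`.
[folklore] -/
def dbrk (U₀ : Site d → Fin d → 𝔸ˣ) (B H : Site d → Fin d → 𝔸) (μ ν : Fin d) (x : Site d) : 𝔸 :=
  (adR (X1 H μ x) (X2 U₀ B μ ν x) + adR (X1 B μ x) (X2 U₀ H μ ν x))
    + (adR (X1 H μ x) (X3 U₀ B μ ν x) + adR (X1 B μ x) (X3 U₀ H μ ν x))
    + (adR (X1 H μ x) (X4 B ν x) + adR (X1 B μ x) (X4 H ν x))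
    + (adR (X2 U₀ H μ ν x) (X3 U₀ B μ ν x) + adR (X2 U₀ B μ ν x) (X3 U₀ H μ ν x))
    + (adR (X2 U₀ H μ ν x) (X4 B ν x) + adR (X2 U₀ B μ ν x) (X4 H ν x))
    + (adR (X3 U₀ H μ ν x) (X4 B ν x) + adR (X3 U₀ B μ ν x) (X4 H ν x))

/-- THE CUBIC COMMUTATOR DENSITY at the plaquette `p_{μν}(x)`: `w · τ((D^η_{U₀}B)(p) · {…}_{U₀,B}(p))` — the SHAPE of
the first term of [Balaban1985Variational] (39) `¼ i tr[(DA)(p)·Σ_{b₁<b₂⊂∂p} i[A′(b₁), A′(b₂)]]` (LOCATOR ONLY: a weight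
`w`, a linear functional `τ`, the plaquette covariant derivative of b08∕B9 (3.4) and the bracket of B8 (1.50)).
[folklore] -/
def cub (w : ℂ) (τ : 𝔸 →L[ℂ] ℂ) (η : ℝ) (U₀ : Site d → Fin d → 𝔸ˣ) (B : Site d → Fin d → 𝔸) (μ ν : Fin d)
    (x : Site d) : ℂ :=
  w * τ (plaqCovDeriv η U₀ B μ ν x * brk U₀ B μ ν x)

/-- ITS FIRST VARIATION in the direction `H`: `w · τ((D^η_{U₀}H)(p) · {…}_B(p) + (D^η_{U₀}B)(p) · δ{…}(B)[H](p))`.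
[folklore] -/
def dcub (w : ℂ) (τ : 𝔸 →L[ℂ] ℂ) (η : ℝ) (U₀ : Site d → Fin d → 𝔸ˣ) (B H : Site d → Fin d → 𝔸) (μ ν : Fin d)
    (x : Site d) : ℂ :=
  w * τ (plaqCovDeriv η U₀ H μ ν x * brk U₀ B μ ν x + plaqCovDeriv η U₀ B μ ν x * dbrk U₀ B H μ ν x)

/-- `[a + t a′, b + t b′] = [a, b] + t([a′, b] + [a, b′]) + t²[a′, b′]`. [folklore] -/
theorem adR_add_smul (a a' b b' : 𝔸) (t : ℂ) :
    adR (a + t • a') (b + t • b') = adR a b + t • (adR a' b + adR a b') + t ^ 2 • adR a' b' := by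
  simp only [adR, add_mul, mul_add, smul_mul_assoc, mul_smul_comm, smul_add, smul_sub, smul_smul, pow_two]
  abel

/-- The four plaquette variables are linear in the field: `xᵢ(B + tH) = xᵢ(B) + t·xᵢ(H)`. [folklore] -/
theorem X1_add_smul (B H : Site d → Fin d → 𝔸) (t : ℂ) (μ : Fin d) (x : Site d) :
    X1 (B + t • H) μ x = X1 B μ x + t • X1 H μ x := rfl

/-- `x₂(B + tH) = x₂(B) + t·x₂(H)`. [folklore] -/
theorem X2_add_smul (U₀ : Site d → Fin d → 𝔸ˣ) (B H : Site d → Fin d → 𝔸) (t : ℂ) (μ ν : Fin d) (x : Site d) :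
    X2 U₀ (B + t • H) μ ν x = X2 U₀ B μ ν x + t • X2 U₀ H μ ν x := by
  simp only [X2, Pi.add_apply, Pi.smul_apply, conjR_add, conjR_smul]

/-- `x₃(B + tH) = x₃(B) + t·x₃(H)`. [folklore] -/
theorem X3_add_smul (U₀ : Site d → Fin d → 𝔸ˣ) (B H : Site d → Fin d → 𝔸) (t : ℂ) (μ ν : Fin d) (x : Site d) :
    X3 U₀ (B + t • H) μ ν x = X3 U₀ B μ ν x + t • X3 U₀ H μ ν x := by
  simp only [X3, Pi.add_apply, Pi.smul_apply, neg_add, conjR_add, ← smul_neg, conjR_smul]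

/-- `x₄(B + tH) = x₄(B) + t·x₄(H)`. [folklore] -/
theorem X4_add_smul (B H : Site d → Fin d → 𝔸) (t : ℂ) (ν : Fin d) (x : Site d) :
    X4 (B + t • H) ν x = X4 B ν x + t • X4 H ν x := by
  simp only [X4, Pi.add_apply, Pi.smul_apply, neg_add, smul_neg]

/-- `Σᵢxᵢ` is linear: `lin(B + tH) = lin B + t·lin H`. [folklore] -/
theorem lin_add_smul (U₀ : Site d → Fin d → 𝔸ˣ) (B H : Site d → Fin d → 𝔸) (t : ℂ) (μ ν : Fin d) (x : Site d) :
    lin U₀ (B + t • H) μ ν x = lin U₀ B μ ν x + t • lin U₀ H μ ν x := by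
  simp only [lin, X1_add_smul, X2_add_smul, X3_add_smul, X4_add_smul, smul_add]
  abel

/-- The plaquette covariant derivative is linear: `D(B + tH) = DB + t·DH`. [folklore] -/
theorem plaqCovDeriv_add_smul (η : ℝ) (U₀ : Site d → Fin d → 𝔸ˣ) (B H : Site d → Fin d → 𝔸) (t : ℂ) (μ ν : Fin d)
    (x : Site d) :
    plaqCovDeriv η U₀ (B + t • H) μ ν x = plaqCovDeriv η U₀ B μ ν x + t • plaqCovDeriv η U₀ H μ ν x := by
  simp only [plaqCovDeriv, lin_add_smul, smul_add, smul_comm (η⁻¹ : ℝ) t]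

/-- THE BRACKET ALONG A LINE: `{…}(B + tH) = {…}(B) + t·δ{…}(B)[H] + t²·{…}(H)`. [folklore] -/
theorem brk_add_smul (U₀ : Site d → Fin d → 𝔸ˣ) (B H : Site d → Fin d → 𝔸) (t : ℂ) (μ ν : Fin d) (x : Site d) :
    brk U₀ (B + t • H) μ ν x = brk U₀ B μ ν x + t • dbrk U₀ B H μ ν x + t ^ 2 • brk U₀ H μ ν x := by
  simp only [brk, dbrk, X1_add_smul, X2_add_smul, X3_add_smul, X4_add_smul, adR_add_smul, smul_add]
  abel

/-- THE CUBIC DENSITY ALONG A LINE is the cubic polynomial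
`cub(B + tH) = w·τ(c₀ + t·c₁ + t²·c₂ + t³·c₃)` with `c₁ = (DH)·{…}(B) + (DB)·δ{…}(B)[H]`. [folklore] -/
theorem cub_add_smul (w : ℂ) (τ : 𝔸 →L[ℂ] ℂ) (η : ℝ) (U₀ : Site d → Fin d → 𝔸ˣ) (B H : Site d → Fin d → 𝔸) (t : ℂ)
    (μ ν : Fin d) (x : Site d) :
    cub w τ η U₀ (B + t • H) μ ν x =
      w * τ (plaqCovDeriv η U₀ B μ ν x * brk U₀ B μ ν x
        + t • (plaqCovDeriv η U₀ H μ ν x * brk U₀ B μ ν x + plaqCovDeriv η U₀ B μ ν x * dbrk U₀ B H μ ν x)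
        + t ^ 2 • (plaqCovDeriv η U₀ H μ ν x * dbrk U₀ B H μ ν x + plaqCovDeriv η U₀ B μ ν x * brk U₀ H μ ν x)
        + t ^ 3 • (plaqCovDeriv η U₀ H μ ν x * brk U₀ H μ ν x)) := by
  rw [cub, plaqCovDeriv_add_smul, brk_add_smul]
  congr 2
  simp only [add_mul, mul_add, smul_mul_assoc, mul_smul_comm, smul_add, smul_smul]
  ring_nf
  abel

/-- **THE FIRST VARIATION**: `t ↦ cub(B + tH)` has derivative `dcub(B)[H]` at `t = 0`. [folklore] -/
theorem hasDerivAt_cub (w : ℂ) (τ : 𝔸 →L[ℂ] ℂ) (η : ℝ) (U₀ : Site d → Fin d → 𝔸ˣ) (B H : Site d → Fin d → 𝔸)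
    (μ ν : Fin d) (x : Site d) :
    HasDerivAt (fun t : ℂ => cub w τ η U₀ (B + t • H) μ ν x) (dcub w τ η U₀ B H μ ν x) 0 := by
  -- abbreviate the four coefficients
  set c₀ := plaqCovDeriv η U₀ B μ ν x * brk U₀ B μ ν x with hc₀
  set c₁ := plaqCovDeriv η U₀ H μ ν x * brk U₀ B μ ν x + plaqCovDeriv η U₀ B μ ν x * dbrk U₀ B H μ ν x with hc₁
  set c₂ := plaqCovDeriv η U₀ H μ ν x * dbrk U₀ B H μ ν x + plaqCovDeriv η U₀ B μ ν x * brk U₀ H μ ν x with hc₂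
  set c₃ := plaqCovDeriv η U₀ H μ ν x * brk U₀ H μ ν x with hc₃
  have hfun : (fun t : ℂ => cub w τ η U₀ (B + t • H) μ ν x) =
      fun t : ℂ => w * τ (c₀ + t • c₁ + t ^ 2 • c₂ + t ^ 3 • c₃) := by
    funext t
    rw [cub_add_smul]
  rw [hfun]
  -- the polynomial `t ↦ c₀ + t c₁ + t² c₂ + t³ c₃` has derivative `c₁` at `0`
  have hp : HasDerivAt (fun t : ℂ => c₀ + t • c₁ + t ^ 2 • c₂ + t ^ 3 • c₃) c₁ 0 := by
    have h1 : HasDerivAt (fun t : ℂ => t • c₁) ((1 : ℂ) • c₁) 0 := (hasDerivAt_id (0 : ℂ)).smul_const c₁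
    have h2 : HasDerivAt (fun t : ℂ => t ^ 2 • c₂) (((2 : ℕ) * (0 : ℂ) ^ (2 - 1)) • c₂) 0 :=
      (hasDerivAt_pow 2 (0 : ℂ)).smul_const c₂
    have h3 : HasDerivAt (fun t : ℂ => t ^ 3 • c₃) (((3 : ℕ) * (0 : ℂ) ^ (3 - 1)) • c₃) 0 :=
      (hasDerivAt_pow 3 (0 : ℂ)).smul_const c₃
    have h := ((h1.const_add c₀).add h2).add h3
    simp at h
    have hfun2 : (fun t : ℂ => c₀ + t • c₁ + t ^ 2 • c₂ + t ^ 3 • c₃) =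
        ((fun t : ℂ => c₀ + t • c₁) + fun t : ℂ => t ^ 2 • c₂) + fun t : ℂ => t ^ 3 • c₃ := by
      funext t
      simp only [Pi.add_apply]
    rw [hfun2]
    exact h
  have hτ : HasDerivAt (fun t : ℂ => τ (c₀ + t • c₁ + t ^ 2 • c₂ + t ^ 3 • c₃)) (τ c₁) 0 :=
    τ.hasFDerivAt.comp_hasDerivAt (0 : ℂ) hp
  have hw := hτ.const_mul w
  rw [dcub]
  exact hw

/-- The first variation of a finite sum of cubic densities. [folklore] -/
theorem hasDerivAt_sum_cub (Pl : Finset (Fin d × Fin d × Site d)) (w : ℂ) (τ : 𝔸 →L[ℂ] ℂ) (η : ℝ)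
    (U₀ : Site d → Fin d → 𝔸ˣ) (B H : Site d → Fin d → 𝔸) :
    HasDerivAt (fun t : ℂ => Pl.sum fun p : Fin d × Fin d × Site d => cub w τ η U₀ (B + t • H) p.1 p.2.1 p.2.2)
      (Pl.sum fun p : Fin d × Fin d × Site d => dcub w τ η U₀ B H p.1 p.2.1 p.2.2) 0 :=
  HasDerivAt.fun_sum fun (p : Fin d × Fin d × Site d) _ => hasDerivAt_cub w τ η U₀ B H p.1 p.2.1 p.2.2

end Algebra

/-! ## §2 The star of a bond -/

section StarComb

/-- THE STAR `st(b)` of the bond `b = ⟨y, y + e_κ⟩` among the INCREASING plaquettes `p_{μν}(x)`, `μ < ν` (B11 (90):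
«st(b) denotes a set of plaquettes p such that b ⊂ ∂p»): the four families `p_{κν}(y)`, `p_{κν}(y − e_ν)` (`ν > κ`)
and `p_{μκ}(y − e_μ)`, `p_{μκ}(y)` (`μ < κ`) — `2(d − 1)` plaquettes. [folklore] -/
def plaqStar (y : Site d) (κ : Fin d) : Finset (Fin d × Fin d × Site d) :=
  (((Ioi κ).image fun ν => (κ, ν, y)) ∪ ((Ioi κ).image fun ν => (κ, ν, y - e ν)))
    ∪ (((Iio κ).image fun μ => (μ, κ, y - e μ)) ∪ ((Iio κ).image fun μ => (μ, κ, y)))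

/-- `e_ν ≠ 0` on `ℤ^d`. [folklore] -/
theorem e_ne_zero (ν : Fin d) : (e ν : Site d) ≠ 0 := by
  intro h
  have := congrArg (fun v : Site d => v ν) h
  simp [B7Prop1Explicit.e_apply] at this

/-- `y − e_ν ≠ y`. [folklore] -/
theorem sub_e_ne (y : Site d) (ν : Fin d) : y - e ν ≠ y := by
  intro h
  exact e_ne_zero ν (by simpa using h)

/-- `y + e_ν ≠ y`. [folklore] -/
theorem add_e_ne (y : Site d) (ν : Fin d) : y + e ν ≠ y := by
  intro h
  exact e_ne_zero ν (by simpa using h)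

/-- `p_{κν}(y) ∈ st(b)` for `ν > κ`. [folklore] -/
theorem mem_plaqStar₁ {y : Site d} {κ ν : Fin d} (h : κ < ν) : (κ, ν, y) ∈ plaqStar y κ := by
  simp only [plaqStar, mem_union, mem_image, mem_Ioi, mem_Iio]
  exact Or.inl (Or.inl ⟨ν, h, rfl⟩)

/-- `p_{κν}(y − e_ν) ∈ st(b)` for `ν > κ`. [folklore] -/
theorem mem_plaqStar₂ {y : Site d} {κ ν : Fin d} (h : κ < ν) : (κ, ν, y - e ν) ∈ plaqStar y κ := by
  simp only [plaqStar, mem_union, mem_image, mem_Ioi, mem_Iio]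
  exact Or.inl (Or.inr ⟨ν, h, rfl⟩)

/-- `p_{μκ}(y − e_μ) ∈ st(b)` for `μ < κ`. [folklore] -/
theorem mem_plaqStar₃ {y : Site d} {κ μ : Fin d} (h : μ < κ) : (μ, κ, y - e μ) ∈ plaqStar y κ := by
  simp only [plaqStar, mem_union, mem_image, mem_Ioi, mem_Iio]
  exact Or.inr (Or.inl ⟨μ, h, rfl⟩)

/-- `p_{μκ}(y) ∈ st(b)` for `μ < κ`. [folklore] -/
theorem mem_plaqStar₄ {y : Site d} {κ μ : Fin d} (h : μ < κ) : (μ, κ, y) ∈ plaqStar y κ := by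
  simp only [plaqStar, mem_union, mem_image, mem_Ioi, mem_Iio]
  exact Or.inr (Or.inr ⟨μ, h, rfl⟩)

/-- THE SUM OVER THE STAR, family by family. [folklore] -/
theorem sum_plaqStar {M : Type*} [AddCommMonoid M] (g : Fin d × Fin d × Site d → M) (y : Site d) (κ : Fin d) :
    ∑ p ∈ plaqStar y κ, g p =
      ∑ ν ∈ Ioi κ, (g (κ, ν, y) + g (κ, ν, y - e ν)) + ∑ μ ∈ Iio κ, (g (μ, κ, y - e μ) + g (μ, κ, y)) := by
  have hi₁ : Set.InjOn (fun ν : Fin d => (κ, ν, y)) (Ioi κ : Finset (Fin d)) := by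
    intro a _ b _ h; simpa using h
  have hi₂ : Set.InjOn (fun ν : Fin d => (κ, ν, y - e ν)) (Ioi κ : Finset (Fin d)) := by
    intro a _ b _ h
    have := congrArg (fun q : Fin d × Fin d × Site d => q.2.1) h
    simpa using this
  have hi₃ : Set.InjOn (fun μ : Fin d => (μ, κ, y - e μ)) (Iio κ : Finset (Fin d)) := by
    intro a _ b _ h
    have := congrArg (fun q : Fin d × Fin d × Site d => q.1) h
    simpa using this
  have hi₄ : Set.InjOn (fun μ : Fin d => (μ, κ, y)) (Iio κ : Finset (Fin d)) := by
    intro a _ b _ h; simpa using h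
  -- pairwise disjointness of the four families
  have d12 : Disjoint ((Ioi κ).image fun ν => (κ, ν, y)) ((Ioi κ).image fun ν => (κ, ν, y - e ν)) := by
    rw [disjoint_iff_ne]
    rintro p hp q hq rfl
    simp only [mem_image, mem_Ioi] at hp hq
    obtain ⟨ν, -, rfl⟩ := hp
    obtain ⟨ν', -, h⟩ := hq
    have := congrArg (fun q : Fin d × Fin d × Site d => q.2.2) h
    exact sub_e_ne y ν' (by simpa using this)
  have d34 : Disjoint ((Iio κ).image fun μ => (μ, κ, y - e μ)) ((Iio κ).image fun μ => (μ, κ, y)) := by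
    rw [disjoint_iff_ne]
    rintro p hp q hq rfl
    simp only [mem_image, mem_Iio] at hp hq
    obtain ⟨μ, -, rfl⟩ := hp
    obtain ⟨μ', -, h⟩ := hq
    have := congrArg (fun q : Fin d × Fin d × Site d => q.2.2) h
    exact sub_e_ne y μ (by simpa using this.symm)
  have dAB : Disjoint (((Ioi κ).image fun ν => (κ, ν, y)) ∪ ((Ioi κ).image fun ν => (κ, ν, y - e ν)))
      (((Iio κ).image fun μ => (μ, κ, y - e μ)) ∪ ((Iio κ).image fun μ => (μ, κ, y))) := by
    rw [disjoint_iff_ne]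
    rintro p hp q hq rfl
    simp only [mem_union, mem_image, mem_Ioi, mem_Iio] at hp hq
    have h1 : p.1 = κ := by
      rcases hp with ⟨ν, -, rfl⟩ | ⟨ν, -, rfl⟩ <;> rfl
    have h2 : p.1 < κ := by
      rcases hq with ⟨μ, hμ, rfl⟩ | ⟨μ, hμ, rfl⟩ <;> exact hμ
    rw [h1] at h2
    exact lt_irrefl κ h2
  rw [plaqStar, sum_union dAB, sum_union d12, sum_union d34, sum_image hi₁, sum_image hi₂, sum_image hi₃,
    sum_image hi₄, sum_add_distrib, sum_add_distrib]

/-- `#st(b) ≤ 2(d − 1)`. [folklore] -/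
theorem card_plaqStar_le (y : Site d) (κ : Fin d) : ((plaqStar y κ).card : ℝ) ≤ 2 * ((d : ℝ) - 1) := by
  have hcard : ((Iio κ).card : ℝ) + ((Ioi κ).card : ℝ) = (d : ℝ) - 1 := by
    have hsum : (Iio κ).card + (Ioi κ).card + 1 = d := by
      rw [Fin.card_Iio, Fin.card_Ioi]; omega
    have hsum' : ((Iio κ).card : ℝ) + ((Ioi κ).card : ℝ) + 1 = (d : ℝ) := by exact_mod_cast hsum
    linarith
  have h : (plaqStar y κ).card ≤ (Ioi κ).card + (Ioi κ).card + ((Iio κ).card + (Iio κ).card) := by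
    unfold plaqStar
    refine (card_union_le _ _).trans (add_le_add ?_ ?_)
    · exact (card_union_le _ _).trans (add_le_add card_image_le card_image_le)
    · exact (card_union_le _ _).trans (add_le_add card_image_le card_image_le)
  have h' : ((plaqStar y κ).card : ℝ) ≤ (Ioi κ).card + (Ioi κ).card + ((Iio κ).card + (Iio κ).card) := by
    exact_mod_cast h
  linarith

/-- Restriction of a sum supported on the star. [folklore] -/
theorem sum_eq_sum_plaqStar {M : Type*} [AddCommMonoid M] {g : Fin d × Fin d × Site d → M}
    {Pl : Finset (Fin d × Fin d × Site d)} {y : Site d} {κ : Fin d} (hst : plaqStar y κ ⊆ Pl)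
    (hincr : ∀ p ∈ Pl, p.1 < p.2.1) (hg : ∀ p ∈ Pl, p.1 < p.2.1 → p ∉ plaqStar y κ → g p = 0) :
    ∑ p ∈ Pl, g p = ∑ p ∈ plaqStar y κ, g p :=
  (sum_subset hst fun p hp hps => hg p hp (hincr p hp) hps).symm

end StarComb

end Summit.QuantumFields.BalabanUV.T4Continuum.ShellMeasureCommutatorVariation

end
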